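import Mathlib
import HarnessLib
import Summits.HubbardSuperconductivity.HubbardSuperconductivity.Theorems.KLProgrammeKLRegimeEngineWtLinesFlowDeep

/-!
# Route `KLProgramme` — crux K3 ENGINE (stmt-HubbardSuperconductivity-20437 `KLRegimeEngineV17F2`), row (b) `stub_engine_step_norms` (e78dfb33d2f7), producer
# hypothesis `hexI`: THE ISO-MOMENT WITNESS `∃ Edu, … ∧ IsoMomFlowAt Edu.1 Edu.2.1 Edu.2.2` FROM THE E1 PLAIN-LINE FAMILY OF `hE4` AND TWO GEOMETRIC DATA
# (osc-free; cell gate-hubbard-kl, seat p3 g24, ITEM 4 of the «(b)-E4/ISO-OSC-SLOT» cure)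

After `…EngineWtLinesFlowDeep` (p728663: `e4FlowAt_of_wplainLine_flow_deep` — the `hE4` witness from ONE E1 family `hplainE1`; `charSumWt_klAniso_single_flow_deep`;
`isoFirstMomentsAt_of_wplainLine_klEng_flow_deep`) and `…EngineIsoResectorisationWt` (p727978: `isoFirstMomentsAt_of_wtAnisoLines_rate`), this file assembles the
`hexI` WITNESS of `A24a1G14.stub_engine_step_norms_of_E1rows` (p727075) — `∃ Edu, 0 ≤ Edu.1 ∧ (∀ P R, 0 ≤ Edu.2.1 P R) ∧ (∀ G P R Q cc, 0 < Edu.2.2 G P R Q cc) ∧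
IsoMomFlowAt Edu.1 Edu.2.1 Edu.2.2` — from:
* `hplainE1` — VERBATIM the E1 family of `e4FlowAt_of_wplainLine_flow_deep` (the `klScaleWt_n`-weighted PLAIN four-leg pinned sums of `𝒱_n[K_n]` at leg `0`
  `≤ klE0·(a·|U| + bfun·(P.Klam·U)²)` under `E4FlowAt`'s binders = `IsoMomFlowAt`'s binders, `a` ABSOLUTE);
* `hiso` — the weighted iso(m) × thin(n−1) character sums at rate `Λ_m` `≤ T_I·M·L²` (`n ≤ m ≤ n_β`; `T_I` absolute; multiplier geometry, p3/p4 class; unweighted twin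
  `charSum_klIso_single_le_of_padded`/`klIsoT`), under the same binders;
* `hthin0` — the weighted single character sums of the scale-`0` thin family `klAnisoFamily … 0` at rates `j ≥ 1` `≤ T₀·M·L²` (only used at `n = 1`, where the
  thin index `n − 1 = 0` is outside `charSumWt_klAniso_single_flow_deep`'s `1 ≤ J`; two sectors, geometry class).
Mechanics: for `2 ≤ n` the thin lines come from §1/§2 of `…WtLinesFlowDeep` (constant `(CT/2)⁴`), for `n = 1` from `hthin0` through `transferSumsWt_klAniso_single_le` +
`wprescribedSum_klAniso_le_of_plain_treeWt` at `J = 0` (constant `(T₀/2)⁴`); the iso step is `isoFirstMomentsAt_of_wtAnisoLines_rate` with `T m := T_I·M·L²`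
(`(3T/(βL²))·ε = 3T_I/2`); the `bfun`-term is put under the threshold (`C·bfun·Klam²·U ≤ 1 ⇒ C·bfun·(Klam U)² ≤ |U|`), so the witness is
`E := C·a + 1` (absolute), `d := 0`, `u := u₀ ⊓ klEngU₀3 ⊓ 1/(|Gfr₃|+1) ⊓ 1/(C·bfun·Klam²+1)`, `C = (81·T_I/2)⁴·max (CT/2)⁴ (T₀/2)⁴·klE0`.
* **`isoMomFlowAt_of_wplainLine_flow_deep`** ⊢ the `hexI` ∃-package, by type.
Everything is proved; no definitions; the three hypothesis families have NO supplier in the tree; nothing asserts them, `hexI`, row (b), any stub, K3 or superconductivity.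
References: BGM 2006 §2.7 (2.66), (2.70)–(2.71a), §2.8 (2.76)–(2.77), (2.82)–(2.84), §3 (3.2)–(3.8) [cite: BenfattoGiulianiMastropietro2006].
-/

noncomputable section

namespace Summit.HubbardSuperconductivity.HubbardSuperconductivity.Theorems.EngineV8

set_option linter.dupNamespace false -- summit = problem name (single-conjunct summit), D-0017

open Classical
open Real Finset Literature.MathematicalPhysics.QuantumLattice Literature.Probability.LatticeModels GrassmannAlgebra
open Literature.Probability.LatticeModels.BattleFederbush
open Literature.MathematicalPhysics.QuantumLattice.FermiRG
open Summit.HubbardSuperconductivity.HubbardSuperconductivity.Theorems.KLProgrammeLegKernels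
open Summit.HubbardSuperconductivity.HubbardSuperconductivity.Theorems.KLRegimeSplit
open Summit.HubbardSuperconductivity.HubbardSuperconductivity.Theorems.TorusFourierL2
open Summit.HubbardSuperconductivity.HubbardSuperconductivity.Theorems.DispersionFlow

/-- `C·b·(K U)² ≤ |U|` once `0 < U ≤ 1/(C·b·K² + 1)` (`C, b ≥ 0`): the quadratic term goes under the threshold. [folklore] -/
theorem mul_sq_le_abs_of_le_threshold {C b K U : ℝ} (hC : 0 ≤ C) (hb : 0 ≤ b) (hU : 0 < U) (hUle : U ≤ 1 / (C * b * K ^ 2 + 1)) :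
    C * b * (K * U) ^ 2 ≤ |U| := by
  rw [abs_of_pos hU]
  have hden : 0 < C * b * K ^ 2 + 1 := by positivity
  have h1 : C * b * K ^ 2 * U ≤ 1 := by
    calc C * b * K ^ 2 * U ≤ C * b * K ^ 2 * (1 / (C * b * K ^ 2 + 1)) := mul_le_mul_of_nonneg_left hUle (by positivity)
      _ = C * b * K ^ 2 / (C * b * K ^ 2 + 1) := by ring
      _ ≤ 1 := by rw [div_le_one hden]; linarith
  calc C * b * (K * U) ^ 2 = (C * b * K ^ 2 * U) * U := by ring
    _ ≤ 1 * U := mul_le_mul_of_nonneg_right h1 hU.le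
    _ = U := one_mul U

/-- **THE ISO-MOMENT WITNESS OF ROW (b) FROM THE E1 PLAIN-LINE FAMILY AND TWO GEOMETRIC DATA — BY TYPE** (see the module docstring for the three hypothesis families
`hplainE1`, `hiso`, `hthin0` and the mechanics): `∃ Edu, 0 ≤ Edu.1 ∧ (∀ P R, 0 ≤ Edu.2.1 P R) ∧ (∀ G P R Q cc, 0 < Edu.2.2 G P R Q cc) ∧ IsoMomFlowAt Edu.1 Edu.2.1 Edu.2.2`
— the type of `hexI` in `A24a1G14.stub_engine_step_norms_of_E1rows`. [cite: BenfattoGiulianiMastropietro2006, §2.7 (2.70)-(2.71a), §2.8 (2.76)-(2.84), §3 (3.2)-(3.8)] -/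
theorem isoMomFlowAt_of_wplainLine_flow_deep {a T_I T₀ : ℝ} (ha : 0 ≤ a) (hTI : 0 ≤ T_I)
    {bfun u₀ : GeoConsts → SplitConsts → RenConsts → EngConsts → ℝ → ℝ}
    (hb : ∀ G P R Q cc, 0 ≤ bfun G P R Q cc) (hu₀ : ∀ G P R Q cc, 0 < u₀ G P R Q cc)
    (hplain : ∀ (G : GeoConsts), G.WF → ∀ (P : SplitConsts) (R : RenConsts) (Q : EngConsts) (cc : ℝ), P.WF → R.WF2 → Q.WF → 0 < cc →
      cc ≤ klEngC₃6 P R → ∀ μ ∈ klWindowC, ∀ U : ℝ, 0 < U → U ≤ u₀ G P R Q cc →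
      ∀ β : ℝ, klBetaMin ≤ β → β ≤ Real.exp (cc / U ^ 2) →
      ∀ (L M : ℕ) [NeZero L] [NeZero M], klEngL₃ β U ≤ L → klEngM₃ β U L ≤ M →
      ∀ n : ℕ, 1 ≤ n → n ≤ nScales β + 1 → IsKLRegime U cc (-(n : ℤ)) →
        HistP klPredsV17F2 L M G P Q R β U μ 0 n → FrameOK R U (nScales β) μ (klFlowFrameU L M β U μ n) →
        ∀ (τ' : Fin 4 → SectorLeg 1) (y : SpaceTimeIdx L M),
          imagTimeWeight β M ^ 3 * ∑ x' ∈ univ.filter (fun x' : Fin 4 → SpaceTimeIdx L M => x' 0 = y),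
            klScaleWt L M β n ((univ.image x').image (fun x : SpaceTimeIdx L M => (((((2 * (x.1 : ℕ) : ℕ)) : ZMod (2 * (2 * M)))), x.2))) *
              ‖sectorisedKernel L M β (trivialMultiplier L M)
                (klEffectiveAction L M β U μ (klFlowFrameU L M β U μ n) klE0 n) 4 τ' x'‖ ≤
          klE0 * (a * |U| + bfun G P R Q cc * (P.Klam * U) ^ 2))
    (hiso : ∀ (G : GeoConsts), G.WF → ∀ (P : SplitConsts) (R : RenConsts) (Q : EngConsts) (cc : ℝ), P.WF → R.WF2 → Q.WF → 0 < cc →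
      cc ≤ klEngC₃6 P R → ∀ μ ∈ klWindowC, ∀ U : ℝ, 0 < U → U ≤ u₀ G P R Q cc →
      ∀ β : ℝ, klBetaMin ≤ β → β ≤ Real.exp (cc / U ^ 2) →
      ∀ (L M : ℕ) [NeZero L] [NeZero M], klEngL₃ β U ≤ L → klEngM₃ β U L ≤ M →
      ∀ n : ℕ, 1 ≤ n → n ≤ nScales β + 1 → IsKLRegime U cc (-(n : ℤ)) →
        HistP klPredsV17F2 L M G P Q R β U μ 0 n → FrameOK R U (nScales β) μ (klFlowFrameU L M β U μ n) →
        ∀ m, n ≤ m → m ≤ nScales β → ∀ (σ : Fin (sectorCount (2 * m))) (a' : Fin (sectorCount (n - 1))),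
          ∑ z : TorusSite 1 (2 * M) × TorusSite 2 L,
            (1 + klScale klE0 m * β / (2 * M) * |(((z.1 0).valMinAbs : ℤ) : ℝ)| + klScale klE0 m * |(((z.2 0).valMinAbs : ℤ) : ℝ)| +
                klScale klE0 m * |(((z.2 1).valMinAbs : ℤ) : ℝ)|) *
            ‖∑ q : TorusSite 1 (2 * M) × TorusSite 2 L, (torusChar q.1 z.1 * torusChar q.2 z.2) •
              (klIsoFamily L M β μ (klFlowFrameU L M β U μ n) klE0 m σ (⟨(q.1 0).val, ZMod.val_lt (q.1 0)⟩, q.2) *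
                klAnisoFamily L M β μ (klFlowFrameU L M β U μ n) klE0 (n - 1) a' (⟨(q.1 0).val, ZMod.val_lt (q.1 0)⟩, q.2))‖ ≤ T_I * M * (L : ℝ) ^ 2)
    (hthin0 : ∀ (G : GeoConsts), G.WF → ∀ (P : SplitConsts) (R : RenConsts) (Q : EngConsts) (cc : ℝ), P.WF → R.WF2 → Q.WF → 0 < cc →
      cc ≤ klEngC₃6 P R → ∀ μ ∈ klWindowC, ∀ U : ℝ, 0 < U → U ≤ u₀ G P R Q cc →
      ∀ β : ℝ, klBetaMin ≤ β → β ≤ Real.exp (cc / U ^ 2) →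
      ∀ (L M : ℕ) [NeZero L] [NeZero M], klEngL₃ β U ≤ L → klEngM₃ β U L ≤ M →
        1 ≤ nScales β + 1 → IsKLRegime U cc (-(1 : ℤ)) →
        HistP klPredsV17F2 L M G P Q R β U μ 0 1 → FrameOK R U (nScales β) μ (klFlowFrameU L M β U μ 1) →
        ∀ j : ℕ, 1 ≤ j → ∀ ω : Fin (sectorCount 0),
          ∑ z : TorusSite 1 (2 * M) × TorusSite 2 L,
            (1 + klScale klE0 j * β / (2 * M) * |(((z.1 0).valMinAbs : ℤ) : ℝ)| + klScale klE0 j * |(((z.2 0).valMinAbs : ℤ) : ℝ)| +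
                klScale klE0 j * |(((z.2 1).valMinAbs : ℤ) : ℝ)|) *
            ‖∑ q : TorusSite 1 (2 * M) × TorusSite 2 L, (torusChar q.1 z.1 * torusChar q.2 z.2) •
              klAnisoFamily L M β μ (klFlowFrameU L M β U μ 1) klE0 0 ω (⟨(q.1 0).val, ZMod.val_lt (q.1 0)⟩, q.2)‖ ≤ T₀ * M * (L : ℝ) ^ 2) :
    ∃ Edu : ℝ × (SplitConsts → RenConsts → ℝ) × (GeoConsts → SplitConsts → RenConsts → EngConsts → ℝ → ℝ),
      0 ≤ Edu.1 ∧ (∀ P R, 0 ≤ Edu.2.1 P R) ∧ (∀ G P R Q cc, 0 < Edu.2.2 G P R Q cc) ∧ IsoMomFlowAt Edu.1 Edu.2.1 Edu.2.2 := by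
  obtain ⟨CT, hCT, hT⟩ := charSumWt_klAniso_single_flow_deep
  have he : (0 : ℝ) < klE0 := by norm_num [klE0]
  -- the overall constant of the iso pinned weighted sum in units of the plain line
  set C : ℝ := (81 * T_I / 2) ^ 4 * max ((CT / 2) ^ 4) ((T₀ / 2) ^ 4) * klE0 with hCdef
  have hC0 : 0 ≤ C := by positivity
  set u₁ : GeoConsts → SplitConsts → RenConsts → EngConsts → ℝ → ℝ :=
    fun G P R Q cc => min (u₀ G P R Q cc) (min (min (klEngU₀3 P R cc) (1 / (|R.Gfr 3| + 1))) (1 / (C * bfun G P R Q cc * P.Klam ^ 2 + 1))) with hu₁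
  have hu₁pos : ∀ G P R Q cc, 0 < u₁ G P R Q cc := fun G P R Q cc => by
    have := hb G P R Q cc
    exact lt_min (hu₀ G P R Q cc) (lt_min (lt_min (klEngU₀3_pos P R cc) (by positivity)) (by positivity))
  refine ⟨(C * a + 1, fun _ _ => 0, u₁), by positivity, fun _ _ => le_rfl, hu₁pos, ?_⟩
  intro G hG P R Q cc hP hR hQ hcc hcc6 μ hμ U hU hUu β hβ hβc L M _ _ hL hM n hn1 hn hreg hhist hfr
  have hU0 : U ≤ u₀ G P R Q cc := hUu.trans (min_le_left _ _)
  have h3 : 0 ≤ R.Gfr 3 := gfr_nonneg_of_wf2 hR 3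
  have hUle : U ≤ min (klEngU₀3 P R cc) (1 / (R.Gfr 3 + 1)) := by
    have h := (hUu.trans (min_le_right _ _)).trans (min_le_left _ _)
    rwa [abs_of_nonneg h3] at h
  have hUth : U ≤ 1 / (C * bfun G P R Q cc * P.Klam ^ 2 + 1) := (hUu.trans (min_le_right _ _)).trans (min_le_right _ _)
  have hβ0 : 0 < β := KLRegimeSplit.pos_of_klBetaMin_le hβ
  have hM0 : (0 : ℝ) < M := Nat.cast_pos.2 (Nat.pos_of_ne_zero (NeZero.ne M))
  have hL0 : (0 : ℝ) < L := Nat.cast_pos.2 (Nat.pos_of_ne_zero (NeZero.ne L))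
  set K : TrigPolyC4v := klFlowFrameU L M β U μ n with hK
  set 𝒱 : HubbardGrassmann L M := klEffectiveAction L M β U μ K klE0 n with h𝒱
  set gpos : SpaceTimeIdx L M → ZMod (2 * (2 * M)) × TorusSite 2 L :=
    fun x => (((((2 * (x.1 : ℕ) : ℕ)) : ZMod (2 * (2 * M)))), x.2) with hgpos
  set N₁ : ℝ := klE0 * (a * |U| + bfun G P R Q cc * (P.Klam * U) ^ 2) with hN₁
  have hN₁0 : 0 ≤ N₁ := by have := hb G P R Q cc; positivity
  have hplain' := hplain G hG P R Q cc hP hR hQ hcc hcc6 μ hμ U hU hU0 β hβ hβc L M hL hM n hn1 hn hreg hhist hfr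
  have hwt : IsTreeWeight (klScaleWt L M β n) := isTreeWeight_klScaleWt L M hβ0.le n
  -- the weighted single character sums of the thin family of index `n − 1` at rate `n`: deep route for `2 ≤ n`, the datum `hthin0` for `n = 1`
  have hsingle : ∀ ω : Fin (sectorCount (n - 1)), ∑ z : TorusSite 1 (2 * M) × TorusSite 2 L,
      (1 + klScale klE0 n * β / (2 * M) * |(((z.1 0).valMinAbs : ℤ) : ℝ)| + klScale klE0 n * |(((z.2 0).valMinAbs : ℤ) : ℝ)| +
          klScale klE0 n * |(((z.2 1).valMinAbs : ℤ) : ℝ)|) *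
      ‖∑ q : TorusSite 1 (2 * M) × TorusSite 2 L, (torusChar q.1 z.1 * torusChar q.2 z.2) •
        klAnisoFamily L M β μ K klE0 (n - 1) ω (⟨(q.1 0).val, ZMod.val_lt (q.1 0)⟩, q.2)‖ ≤ max CT T₀ * M * (L : ℝ) ^ 2 := by
    intro ω
    rcases Nat.lt_or_ge n 2 with hn2 | hn2
    · obtain rfl : n = 1 := by omega
      refine (hthin0 G hG P R Q cc hP hR hQ hcc hcc6 μ hμ U hU hU0 β hβ hβc L M hL hM hn hreg hhist hfr 1 le_rfl ω).trans ?_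
      exact mul_le_mul_of_nonneg_right (mul_le_mul_of_nonneg_right (le_max_right _ _) hM0.le) (by positivity)
    · refine (hT G P R Q cc hR hcc hcc6 μ hμ U hU hUle β hβ hβc L M hL hM n hn1 hn hhist hfr (n - 1) n (by omega) (Nat.sub_le n 1)
        (by omega) le_rfl ω).trans ?_
      exact mul_le_mul_of_nonneg_right (mul_le_mul_of_nonneg_right (le_max_left _ _) hM0.le) (by positivity)
  set Cs : ℝ := max CT T₀ with hCs
  have hCs0 : 0 ≤ Cs := le_trans hCT.le (le_max_left _ _)
  have hc0 : 0 ≤ Cs * M * (L : ℝ) ^ 2 / (β * (L : ℝ) ^ 2) := by positivity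
  obtain ⟨hrowS, hcolS⟩ := transferSumsWt_klAniso_single_le hβ0 μ K (n - 1) n hsingle
  have hq : Cs * M * (L : ℝ) ^ 2 / (β * (L : ℝ) ^ 2) * imagTimeWeight β M = Cs / 2 := by
    unfold imagTimeWeight
    field_simp
  -- the weighted thin per-tuple pinned lines (index `n − 1`, leg `0`, rate `n`) of `𝒱_n[K_n]`
  have hBF : ∀ (σ' : Fin 4 → SectorLeg (sectorCount (n - 1))) (y : SpaceTimeIdx L M),
      imagTimeWeight β M ^ 3 * ∑ x' ∈ univ.filter (fun x' : Fin 4 → SpaceTimeIdx L M => x' 0 = y),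
        klScaleWt L M β n ((univ.image x').image gpos) * ‖klAnisoKernelAt L M β U μ K n (n - 1) σ' x'‖ ≤ (Cs / 2) ^ 4 * N₁ := by
    intro σ' y
    have hline := wprescribedSum_klAniso_le_of_plain_treeWt hwt gpos hβ0 μ K (n - 1) 𝒱 hc0 hc0 hN₁0
      (fun ω'' s c x' => hcolS ω'' s c x') (fun ω'' s c x'' => hrowS ω'' s c x'') 3 σ' 0 hplain' y
    refine hline.trans (le_of_eq ?_)
    calc (Cs * M * (L : ℝ) ^ 2 / (β * (L : ℝ) ^ 2)) ^ 3 * (Cs * M * (L : ℝ) ^ 2 / (β * (L : ℝ) ^ 2)) * imagTimeWeight β M ^ (3 + 1) * N₁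
        = (Cs * M * (L : ℝ) ^ 2 / (β * (L : ℝ) ^ 2) * imagTimeWeight β M) ^ 4 * N₁ := by ring
      _ = (Cs / 2) ^ 4 * N₁ := by rw [hq]
  -- the iso step with `T m := T_I·M·L²` and the fit at `(E, d) = (C·a + 1, 0)`
  have hiso' := hiso G hG P R Q cc hP hR hQ hcc hcc6 μ hμ U hU hU0 β hβ hβc L M hL hM n hn1 hn hreg hhist hfr
  refine isoFirstMomentsAt_of_wtAnisoLines_rate hβ0 U μ P n (n₂ := n - 1) (by omega) (T := fun _ => T_I * M * (L : ℝ) ^ 2)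
    (fun _ => by positivity) (by positivity) hiso' hBF fun m _ _ => ?_
  have hqI : 3 * (T_I * M * (L : ℝ) ^ 2) / (β * (L : ℝ) ^ 2) * imagTimeWeight β M = 3 * T_I / 2 := by
    unfold imagTimeWeight
    field_simp
  have hCs4 : (Cs / 2) ^ 4 ≤ max ((CT / 2) ^ 4) ((T₀ / 2) ^ 4) := by
    rcases le_total CT T₀ with h | h
    · rw [hCs, max_eq_right h]; exact le_max_right _ _
    · rw [hCs, max_eq_left h]; exact le_max_left _ _
  have hquad : C * bfun G P R Q cc * (P.Klam * U) ^ 2 ≤ |U| := mul_sq_le_abs_of_le_threshold hC0 (hb G P R Q cc) hU hUth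
  have hlhs : (3 * (T_I * M * (L : ℝ) ^ 2) / (β * (L : ℝ) ^ 2)) ^ 3 * (3 * (T_I * M * (L : ℝ) ^ 2) / (β * (L : ℝ) ^ 2)) * 27 ^ 4 *
        imagTimeWeight β M ^ 3 * (imagTimeWeight β M * ((Cs / 2) ^ 4 * N₁)) =
      (3 * (T_I * M * (L : ℝ) ^ 2) / (β * (L : ℝ) ^ 2) * imagTimeWeight β M) ^ 4 * 27 ^ 4 * (Cs / 2) ^ 4 * N₁ := by ring
  rw [hlhs, hqI]
  have hε4 : (3 * T_I / 2) ^ 4 * 27 ^ 4 = (81 * T_I / 2) ^ 4 := by ring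
  rw [hε4]
  have hmain : (81 * T_I / 2) ^ 4 * (Cs / 2) ^ 4 * N₁ ≤ C * (a * |U| + bfun G P R Q cc * (P.Klam * U) ^ 2) := by
    rw [hCdef, hN₁]
    have h1 : (81 * T_I / 2) ^ 4 * (Cs / 2) ^ 4 ≤ (81 * T_I / 2) ^ 4 * max ((CT / 2) ^ 4) ((T₀ / 2) ^ 4) :=
      mul_le_mul_of_nonneg_left hCs4 (by positivity)
    have h2 : 0 ≤ klE0 * (a * |U| + bfun G P R Q cc * (P.Klam * U) ^ 2) := hN₁0
    nlinarith [mul_le_mul_of_nonneg_right h1 h2]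
  calc (81 * T_I / 2) ^ 4 * (Cs / 2) ^ 4 * N₁ ≤ C * (a * |U| + bfun G P R Q cc * (P.Klam * U) ^ 2) := hmain
    _ = C * a * |U| + C * bfun G P R Q cc * (P.Klam * U) ^ 2 := by ring
    _ ≤ C * a * |U| + |U| := by linarith
    _ = (C * a + 1) * |U| + 0 * (P.Klam * U) ^ 2 := by ring

end Summit.HubbardSuperconductivity.HubbardSuperconductivity.Theorems.EngineV8

end
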